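import Summits.ABC.IUTFork.Repair.RHReqsideWeightLaws
import Summits.ABC.IUTFork.Repair.RHToptLicenceOnlyLowerBound
import HarnessLib

/-!
# D-0122 AXIS B «REQUIREMENT-SIDE REDESIGN», knobs k1/k2/k5 — THE TYPED FORM, part 2: the requirement `M_mod`, the k2 label-set demand, the
# k5 threshold `T(μ₀) = (μ₀M − K)⁺` calibrated against the threshold of record (`RH.SigmaMass`) and the information model (`RH.ToptModel`),
# and the DOWNSTREAM constant `u_f(l)` in closed form per law

abc-iut cell, rung LADDER-ABC:A2.RESCUE.H; seat abc-iut-reqb-typ-1 (D-0122 axis B typer k1/k2/k5); spec of record abc-iut-rh-lead g3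
`plan/rescue/R-H/ROUND3/REQB-SPEC.md` v0.1 a4e13bdf46b62951 §1/§3/§5 («closed-form identities for `T_mod` and `u_f(l)`»); referee abc-iut-reqb-ref-1. Part 1 =
`Repair/RHReqsideWeightLaws.lean` (laws `lawPow`/`lawShift`/`lawAffine`, the k1-cell `Cell`, `demandSum` with its closed forms, worked place). Composed BY NAME
over abc-iut-rh2-T-1's `RH.SigmaMass` (p477034: `totalTrivialMass`, `onTrivialMass`, `offTrivialMass`, `massThreshold`, `onTrivialMass_add_offTrivialMass`) and
topt-pv-1's `RH.ToptModel.le_iff_forall_licenceConsistent` (`Repair/RHToptLicenceOnlyLowerBound.lean`); nothing re-typed.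
* §1 REQUIREMENT BOOKKEEPING: the `κ = 3/2` majorant `2·Σ_{j≤n}(⌈j^{3/2}⌉ − 1) ≤ ⌈√n⌉·n(n+1) − 2n`; integer-`κ` laws have the polynomial sums; the
  OFF-SEGMENT split `demandSum n = demandSum j₀ + Σ_{j₀<j≤n}` (REQB-SPEC §3 «seg = 1»: `K_L0(w) = (demandSum f den j₀(w)/den)·m_q u_w`, `T_mod = M_mod − K_L0`);
  k2 `demandSumOn J f den = Σ_{j∈J}(f(j) − den)` with truncation `{1..L}` = `demandSum … L`; `reqMass f den l⋆ U = (demandSum/den)·U` (`U = Σ_w m_q(w)u_w`) and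
  **`M_mod/M_print = demandSum_f/demandSum_print`, a function of `(f, l)` ALONE** (`reqMass_div_reqMass`).
* §2 k5 TARGET: `reqThreshold μ₀ M K = (μ₀·M − K)⁺`; **`= 0 ⟺ μ₀M ≤ K`** (the «ratio ≥ 1» / CLOSES cell); at `μ₀ = 1` over ANY verbatim `Cor312.Setting`
  (bridge hypotheses) **`reqThreshold 1 M mass(σ) = B_triv(σᶜ) = offTrivialMass P σ`** — the licence-only threshold `T` of record — and `= (massThreshold P K)⁺`;
  the k1-modified cost table `lawCost f den q` of the information model inherits «c = 1 / WEIGHTS NEVER MATTER»: under EVERY law the licence-only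
  `T_mod(σ) = PN Σᶠ 1_{σᶜ}·t_f` is EXACTLY the least certified `ε` (`lawOffMass_le_iff_forall_licenceConsistent`) — the knob moves `T`'s VALUE, never the dual.
* §3 DOWNSTREAM `uConst f den l n := 2l·(n(n+3)/2)/(demandSum f den n/den)` (`n = l⋆`; `Σ_{j≤n}(j+1) = n(n+3)/2`, `RH.CellWeights.sum_fin_labelSlots`; the number
  replacing «6» in the Szpiro-type display, REQB-SPEC §3): PRINT `6l(l+5)/((l−3)(l+4))` (= abc-iut-rh2-w-2's `RH.CellWeights.uniformConstant_eq` p488865, re-derived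
  from `demandSum`); `κ = 1`: `2l(l+5)/(l−3) > 2l` — UNBOUNDED along `l` (REQB-SPEC §4 KEEP needs «downstream constant finite»); shift `a`:
  `6l(l+5)/((l−3)(l+4+6a))`; affine `c/den`: `6·l·den·(n+3)/(c(n+1)(2n+1) − 6den)` (`→ 6/c₁`); `κ = 3/2`: `≥ 2l/⌈√l⋆⌉` (UNBOUNDED); `κ = 5/2`: `≤` print's (finite).
HONEST FRAMING: real/integer bookkeeping about OUR typed functional with a free pilot law (a PARAMETER, REQB-SPEC FRAMING — not a claim that IUT I–III admit
it); nothing here asserts that abc is proved or refuted, or that [IUTchIII] Cor. 3.12 / [IUTchIV] Thm. 1.10 holds or fails at any datum, or takes a side on any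
author; typed ≠ proved; computed ≠ proved. [claim: Mochizuki2012, status: disputed] for every IUT locution.
[cite: Mochizuki2012, IUTchIII Cor. 3.12 p. 173–174, Prop. 3.9 (i) p. 116, Rmk. 3.9.3 p. 119–120; IUTchIV Thm. 1.10 Step (v) p. 27–29]
-/

noncomputable section

open Finset Set Function

namespace Summit.ABC.IUTFork.Repair.RH.ReqsideWeightLaws

open Summit.ABC.IUTFork.Repair.RH.DiffPricedHull Literature.IUT.LogThetaLattice Summit.ABC.IUTFork.Thm311
  Summit.ABC.IUTFork.Cor312 Summit.ABC.IUTFork.Cor312Vol Summit.ABC.IUTFork.Repair.RH.SigmaMass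

/-! ## §1. Requirement bookkeeping: majorants, off-segment split, k2 label sets, `M_mod` -/

/-- Auxiliary closed form `2·Σ_{i<n}((i+1)c − 1) = c·n(n+1) − 2n`. [folklore] -/
theorem two_mul_sum_range_linear (c : ℤ) (n : ℕ) :
    2 * ∑ i ∈ Finset.range n, (((i : ℤ) + 1) * c - 1) = c * n * (n + 1) - 2 * n := by
  induction n with
  | zero => simp
  | succ n ih => rw [Finset.sum_range_succ, mul_add, ih]; push_cast; ring

/-- **`κ = 3/2` MAJORANT: `2·Σ_{j≤n}(⌈j^{3/2}⌉ − 1) ≤ ⌈√n⌉·n(n+1) − 2n`** (`⌈j^{3/2}⌉ ≤ j⌈√j⌉ ≤ j⌈√n⌉`). [folklore] -/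
theorem two_mul_demandSum_lawPow_three_le (n : ℕ) :
    2 * demandSum (lawPow 3) 1 n ≤ (ceilSqrt n : ℤ) * n * (n + 1) - 2 * n := by
  have hle : demandSum (lawPow 3) 1 n ≤ ∑ i ∈ Finset.range n, (((i : ℤ) + 1) * (ceilSqrt n : ℤ) - 1) := by
    refine Finset.sum_le_sum fun i hi => ?_
    rw [Finset.mem_range] at hi
    have h1 := lawPow_three_le_mul_ceilSqrt (i + 1)
    have h3 : (i + 1) * ceilSqrt (i + 1) ≤ (i + 1) * ceilSqrt n := Nat.mul_le_mul_left _ (ceilSqrt_mono (by omega))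
    have h4 : lawPow 3 (i + 1) ≤ (((i + 1) * ceilSqrt n : ℕ) : ℤ) := h1.trans (by exact_mod_cast h3)
    push_cast at h4
    linarith
  have := two_mul_sum_range_linear (ceilSqrt n : ℤ) n
  linarith


/-- The κ-laws at integer `κ` have the polynomial demand sums. [folklore] -/
theorem demandSum_lawPow_two_four_six (den : ℤ) (n : ℕ) :
    demandSum (lawPow 2) den n = demandSum (fun j => (j : ℤ)) den n ∧
      demandSum (lawPow 4) den n = demandSum (fun j => (j : ℤ) ^ 2) den n ∧
        demandSum (lawPow 6) den n = demandSum (fun j => (j : ℤ) ^ 3) den n :=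
  ⟨demandSum_congr (fun j _ => lawPow_two j) den n, demandSum_congr (fun j _ => lawPow_four j) den n,
    demandSum_congr (fun j _ => lawPow_six j) den n⟩


/-- OFF-SEGMENT SPLIT: for `j₀ ≤ n`, `demandSum f den n = demandSum f den j₀ + Σ_{j₀ < j ≤ n}(f(j) − den)` — the place's demand off its slice
`{1..j₀}` (REQB-SPEC §3 «seg = 1»: kept `K_L0(w) = (demandSum f den j₀(w)/den)·m_q u_w`, `T_mod = M_mod − K_L0`). [folklore] -/
theorem demandSum_eq_add_offSegment (f : ℕ → ℤ) (den : ℤ) {j₀ n : ℕ} (h : j₀ ≤ n) :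
    demandSum f den n = demandSum f den j₀ + ∑ i ∈ Finset.Ico j₀ n, (f (i + 1) - den) := by
  unfold demandSum
  rw [Finset.sum_range_add_sum_Ico _ h]

/-- **k2 LABEL SET**: the demand of a label set `J` (truncation `{1..L}`, parity subsets …): `demandSumOn J f den := Σ_{j∈J}(f(j) − den)`.
[claim: Mochizuki2012, status: disputed] -/
@[claim "Mochizuki2012" "disputed"]
def demandSumOn (J : Finset ℕ) (f : ℕ → ℤ) (den : ℤ) : ℤ := ∑ j ∈ J, (f j - den)

/-- Truncation `J = {1..L}` is `demandSum … L` (k2 «L ∈ {⌈l⋆/2⌉, ⌈√l⋆⌉}»; print `L = l⋆`). [folklore] -/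
theorem demandSumOn_Icc (f : ℕ → ℤ) (den : ℤ) (L : ℕ) : demandSumOn (Finset.Icc 1 L) f den = demandSum f den L := by
  induction L with
  | zero => simp [demandSumOn, demandSum]
  | succ L ih =>
    unfold demandSumOn at ih ⊢
    rw [Finset.sum_Icc_succ_top (Nat.succ_le_succ (Nat.zero_le L)), ih, demandSum_succ]

/-- **`M_mod`**: the requirement (total trivial mass) under the law `f/den` with `l⋆` labels and place total `U = Σ_w m_q(w)·u_w`:
`reqMass f den l⋆ U := (demandSum f den l⋆/den)·U`. [claim: Mochizuki2012, status: disputed] -/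
@[claim "Mochizuki2012" "disputed"]
def reqMass (f : ℕ → ℤ) (den : ℤ) (lstar : ℕ) (U : ℝ) : ℝ := ((demandSum f den lstar : ℤ) : ℝ) / (den : ℝ) * U

/-- **THE REQUIREMENT COLUMN IS `(f, l)`-ONLY: `M_mod/M_print = demandSum_f(l⋆)/demandSum_print(l⋆)`** — place factors cancel (same `den`).
[folklore] -/
theorem reqMass_div_reqMass {f g : ℕ → ℤ} {den : ℤ} {lstar : ℕ} {U : ℝ} (hU : U ≠ 0) (hden : den ≠ 0)
    (hg : demandSum g den lstar ≠ 0) :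
    reqMass f den lstar U / reqMass g den lstar U = (demandSum f den lstar : ℝ) / (demandSum g den lstar : ℝ) := by
  unfold reqMass
  have hden' : (den : ℝ) ≠ 0 := by exact_mod_cast hden
  have hg' : ((demandSum g den lstar : ℤ) : ℝ) ≠ 0 := by exact_mod_cast hg
  field_simp

/-- **k5 TARGET `μ₀`**: the requirement-side threshold `reqThreshold μ₀ M K := (μ₀·M − K)⁺` (REQB-SPEC §1 k5: `Req = μ₀M`, kept `K = K_L0`;
print `μ₀ = 1`: `T = M − K_L0 = (1 − μ₄)M`). [claim: Mochizuki2012, status: disputed] -/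
@[claim "Mochizuki2012" "disputed"]
def reqThreshold (μ₀ M K : ℝ) : ℝ := max (μ₀ * M - K) 0

/-- **The «ratio ≥ 1» cell: `reqThreshold μ₀ M K = 0 ⟺ μ₀·M ≤ K`** (kept ≥ requirement). [folklore] -/
theorem reqThreshold_eq_zero_iff (μ₀ M K : ℝ) : reqThreshold μ₀ M K = 0 ↔ μ₀ * M ≤ K := by
  unfold reqThreshold
  constructor
  · intro h
    have := le_max_left (μ₀ * M - K) 0
    rw [h] at this; linarith
  · intro h; exact max_eq_right (by linarith)

/-! ## §2. k5 threshold, calibration with the threshold of record and the information model -/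

section Setting

variable {ι : ThetaIndex} {S : Situation ι} {P : Cor312.Setting S}

/-- **CALIBRATION WITH THE THRESHOLD OF RECORD** (over ANY verbatim setting, bridge hypotheses): at `μ₀ = 1`, `M = totalTrivialMass P`, kept
`K = onTrivialMass P σ`, the k5-threshold IS the licence-only threshold `B_triv(σᶜ) = offTrivialMass P σ` of abc-iut-rh2-T-1 / topt-pv-1.
[claim: Mochizuki2012, status: disputed] -/
theorem reqThreshold_one_eq_offTrivialMass (H : BridgeHyps P) (σ : Set (Fin ι.lstar × ι.VQ)) :
    reqThreshold 1 (totalTrivialMass P) (onTrivialMass P σ) = offTrivialMass P σ := by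
  unfold reqThreshold
  rw [one_mul, ← onTrivialMass_add_offTrivialMass H σ, add_sub_cancel_left]
  exact max_eq_left (offTrivialMass_nonneg σ)

/-- … and for a general kept mass `K` it is `(massThreshold P K)⁺` (`massThreshold P K = M − K`, `RH.SigmaMass`). [folklore] -/
theorem reqThreshold_one_eq_massThreshold_pos (K : ℝ) : reqThreshold 1 (totalTrivialMass P) K = max (massThreshold P K) 0 := by
  unfold reqThreshold massThreshold; rw [one_mul]

end Setting

section Model

variable {lstar : ℕ} {V : Type*}

/-- **The k1-modified trivial-cost table of the information model** (`RH.ToptModel`, topt-pv-1): `t_f(i, v) := ((f(i+1) − den)/den)·q(v)` with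
`q(v) = m_q(v)·u_v ≥ 0` the place weight. [claim: Mochizuki2012, status: disputed] -/
@[claim "Mochizuki2012" "disputed"]
def lawCost (f : ℕ → ℤ) (den : ℤ) (q : V → ℝ) : Fin lstar × V → ℝ :=
  fun c => ((f (c.1 + 1) - den : ℤ) : ℝ) / (den : ℝ) * q c.2

/-- The modified costs are `≥ 0` when `f ≥ den` on labels `≥ 1` and `q ≥ 0`. [folklore] -/
theorem lawCost_nonneg {f : ℕ → ℤ} {den : ℤ} (hden : 0 < den) (hf : ∀ j, 1 ≤ j → den ≤ f j) {q : V → ℝ} (hq : ∀ v, 0 ≤ q v)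
    (c : Fin lstar × V) : 0 ≤ lawCost f den q c := by
  unfold lawCost
  have h1 : (0 : ℝ) ≤ ((f (c.1 + 1) - den : ℤ) : ℝ) := by exact_mod_cast sub_nonneg.mpr (hf _ (Nat.succ_pos _))
  have h2 : (0 : ℝ) < (den : ℝ) := by exact_mod_cast hden
  exact mul_nonneg (div_nonneg h1 h2.le) (hq _)

/-- **«c = 1» UNDER EVERY LAW** (topt-pv-1's `RH.ToptModel.le_iff_forall_licenceConsistent` at `t := lawCost f den q`): the licence-only threshold
`T_mod(σ) = PN Σᶠ 1_{σᶜ}·t_f` is EXACTLY the least `ε` certified by every table consistent with {licence on `σ`, honest cone} — the k1 knob moves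
`T`'s VALUE (§2 closed forms), never the dual multiplier. [folklore] -/
theorem lawOffMass_le_iff_forall_licenceConsistent {f : ℕ → ℤ} {den : ℤ} (hden : 0 < den) (hf : ∀ j, 1 ≤ j → den ≤ f j)
    {q : V → ℝ} (hq : ∀ v, 0 ≤ q v) (hqs : (Function.support q).Finite) (σ : Set (Fin lstar × V)) (ε : ℝ) :
    processionNormalized (fun i : Fin lstar => ∑ᶠ v : V, σᶜ.indicator (lawCost f den q) (i, v)) ≤ ε ↔
      ∀ d : Fin lstar × V → ℝ, (∀ i : Fin lstar, (Function.support fun v : V => d (i, v)).Finite) →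
        (∀ c, d c ≤ lawCost f den q c) → (∀ c ∈ σ, d c ≤ 0) →
          processionNormalized (fun i : Fin lstar => ∑ᶠ v : V, d (i, v)) ≤ ε :=
  ToptModel.le_iff_forall_licenceConsistent σ (lawCost_nonneg hden hf hq)
    (fun _ => hqs.subset (Function.support_mul_subset_right _ _)) ε

end Model

/-! ## §3. The DOWNSTREAM constant `u_f(l)` -/

/-- **`u_f(l) := 2l·Σ_{j≤n}(j+1) / (Σ_{j≤n}(f(j) − den)/den)`**, `n = l⋆`, `Σ_{j≤n}(j+1) = n(n+3)/2` (`RH.CellWeights.sum_fin_labelSlots`): the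
error-per-gap constant of a Thm 1.10-type chain under the law `f/den` with print's packet dimension `j+1` (REQB-SPEC §3 DOWNSTREAM «the number
replacing 6»). [claim: Mochizuki2012, status: disputed] -/
@[claim "Mochizuki2012" "disputed"]
def uConst (f : ℕ → ℤ) (den : ℤ) (l n : ℕ) : ℝ :=
  2 * (l : ℝ) * ((n : ℝ) * (n + 3) / 2) / (((demandSum f den n : ℤ) : ℝ) / (den : ℝ))

/-- **PRINT: `u(l) = 6l(l+5)/((l−3)(l+4))`** at `l = 2n+1`, `n ≥ 2` (abc-iut-rh2-w-2's `uniformConstant_eq`, from `demandSum`). [folklore] -/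
theorem uConst_sq {n : ℕ} (hn : 2 ≤ n) :
    uConst (fun j => (j : ℤ) ^ 2) 1 (2 * n + 1) n =
      6 * (2 * (n : ℝ) + 1) * ((2 * (n : ℝ) + 1) + 5) / (((2 * (n : ℝ) + 1) - 3) * ((2 * (n : ℝ) + 1) + 4)) := by
  have hD : ((demandSum (fun j => (j : ℤ) ^ 2) 1 n : ℤ) : ℝ) = (n : ℝ) * (n - 1) * (2 * n + 5) / 6 := by
    have h := congrArg (fun z : ℤ => (z : ℝ)) (six_mul_demandSum_sq n); push_cast at h; linarith
  unfold uConst; rw [hD]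
  have h2 : (2 : ℝ) ≤ n := by exact_mod_cast hn
  have h1 : (n : ℝ) - 1 ≠ 0 := by linarith
  have h0 : (n : ℝ) ≠ 0 := by linarith
  have h5 : (2 : ℝ) * n + 5 ≠ 0 := by linarith
  have h3 : (2 * (n : ℝ) + 1) - 3 ≠ 0 := by linarith
  have h4 : (2 * (n : ℝ) + 1) + 4 ≠ 0 := by linarith
  push_cast
  field_simp
  ring

/-- **`κ = 1`: `u₁(l) = 2l(l+5)/(l−3)`** (`l = 2n+1`, `n ≥ 2`). [folklore] -/
theorem uConst_id {n : ℕ} (hn : 2 ≤ n) :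
    uConst (fun j => (j : ℤ)) 1 (2 * n + 1) n = 2 * (2 * (n : ℝ) + 1) * ((2 * (n : ℝ) + 1) + 5) / ((2 * (n : ℝ) + 1) - 3) := by
  have hD : ((demandSum (fun j => (j : ℤ)) 1 n : ℤ) : ℝ) = (n : ℝ) * (n - 1) / 2 := by
    have h := congrArg (fun z : ℤ => (z : ℝ)) (two_mul_demandSum_id n); push_cast at h; linarith
  unfold uConst; rw [hD]
  have h2 : (2 : ℝ) ≤ n := by exact_mod_cast hn
  have h1 : (n : ℝ) - 1 ≠ 0 := by linarith
  have h0 : (n : ℝ) ≠ 0 := by linarith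
  have h3 : (2 * (n : ℝ) + 1) - 3 ≠ 0 := by linarith
  push_cast
  field_simp
  ring

/-- **… which exceeds `2l`: under `κ = 1` the downstream constant is UNBOUNDED along `l`** (at a fixed tabulated `l` it is a number; REQB-SPEC §4 KEEP
needs «downstream constant finite»). [folklore] -/
theorem two_mul_lt_uConst_id {n : ℕ} (hn : 2 ≤ n) : 2 * (2 * (n : ℝ) + 1) < uConst (fun j => (j : ℤ)) 1 (2 * n + 1) n := by
  rw [uConst_id hn]
  have h2 : (2 : ℝ) ≤ n := by exact_mod_cast hn
  have hpos : (0 : ℝ) < (2 * (n : ℝ) + 1) - 3 := by linarith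
  rw [lt_div_iff₀ hpos]
  nlinarith

/-- **SHIFT `a`: `u(l) = 6l(l+5)/((l−3)(l+4+6a))`** (`l = 2n+1`, `n ≥ 2`) — finite, below print's. [folklore] -/
theorem uConst_shift (a : ℕ) {n : ℕ} (hn : 2 ≤ n) :
    uConst (lawShift a) 1 (2 * n + 1) n =
      6 * (2 * (n : ℝ) + 1) * ((2 * (n : ℝ) + 1) + 5) / (((2 * (n : ℝ) + 1) - 3) * ((2 * (n : ℝ) + 1) + 4 + 6 * a)) := by
  have hD : ((demandSum (lawShift a) 1 n : ℤ) : ℝ) = (n : ℝ) * (n - 1) * (2 * n + 5 + 6 * a) / 6 := by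
    have h := congrArg (fun z : ℤ => (z : ℝ)) (six_mul_demandSum_shift a n); push_cast at h; linarith
  unfold uConst; rw [hD]
  have h2 : (2 : ℝ) ≤ n := by exact_mod_cast hn
  have ha : (0 : ℝ) ≤ a := Nat.cast_nonneg a
  have h1 : (n : ℝ) - 1 ≠ 0 := by linarith
  have h0 : (n : ℝ) ≠ 0 := by linarith
  have h5 : (2 : ℝ) * n + 5 + 6 * a ≠ 0 := by linarith
  have h3 : (2 * (n : ℝ) + 1) - 3 ≠ 0 := by linarith
  have h4 : (2 * (n : ℝ) + 1) + 4 + 6 * a ≠ 0 := by linarith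
  push_cast
  field_simp
  ring

/-- **AFFINE `c/den`: `u(l) = 6·l·den·(n+3)/(c(n+1)(2n+1) − 6den)`** (`n ≥ 1`, `6den < c(n+1)(2n+1)`; `→ 6·den/c = 6/c₁`). [folklore] -/
theorem uConst_affine (c : ℕ) {den : ℤ} (hden : 0 < den) {n : ℕ} (hn : 1 ≤ n) (hc : 6 * den < (c : ℤ) * (n + 1) * (2 * n + 1)) (l : ℕ) :
    uConst (lawAffine c) den l n =
      6 * (l : ℝ) * den * ((n : ℝ) + 3) / ((c : ℝ) * (n + 1) * (2 * n + 1) - 6 * den) := by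
  have hD : ((demandSum (lawAffine c) den n : ℤ) : ℝ) = ((c : ℝ) * n * (n + 1) * (2 * n + 1) - 6 * den * n) / 6 := by
    have h := congrArg (fun z : ℤ => (z : ℝ)) (six_mul_demandSum_affine c den n); push_cast at h; linarith
  unfold uConst; rw [hD]
  have hn' : (1 : ℝ) ≤ n := by exact_mod_cast hn
  have h0 : (n : ℝ) ≠ 0 := by linarith
  have hd : (den : ℝ) ≠ 0 := by exact_mod_cast hden.ne'
  have hc' : (6 : ℝ) * den < (c : ℝ) * (n + 1) * (2 * n + 1) := by exact_mod_cast hc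
  have h6 : (c : ℝ) * (n + 1) * (2 * n + 1) - 6 * den ≠ 0 := by linarith
  have h7 : ((c : ℝ) * n * (n + 1) * (2 * n + 1) - 6 * den * n) ≠ 0 := by
    have : ((c : ℝ) * n * (n + 1) * (2 * n + 1) - 6 * den * n) = n * ((c : ℝ) * (n + 1) * (2 * n + 1) - 6 * den) := by ring
    rw [this]; exact mul_ne_zero h0 h6
  field_simp

/-- **`κ = 3/2`: `u(l) ≥ 2l/⌈√n⌉`** (`n = l⋆ ≥ 2`): UNBOUNDED along `l` (`≥ 2l/(√l⋆ + 1) ≍ √(8l)`). [folklore] -/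
theorem uConst_lawPow_three_ge {n : ℕ} (hn : 2 ≤ n) (l : ℕ) : 2 * (l : ℝ) / (ceilSqrt n : ℝ) ≤ uConst (lawPow 3) 1 l n := by
  unfold uConst
  have hn' : (2 : ℝ) ≤ n := by exact_mod_cast hn
  have hc1 : 1 ≤ ceilSqrt n := succ_le_ceilSqrt_of_sq_lt (by simpa using Nat.pos_of_ne_zero (by omega))
  have hc : (1 : ℝ) ≤ (ceilSqrt n : ℝ) := by exact_mod_cast hc1
  have hDge : ((demandSum (fun j => (j : ℤ)) 1 n : ℤ) : ℝ) ≤ ((demandSum (lawPow 3) 1 n : ℤ) : ℝ) := by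
    exact_mod_cast (demandSum_halfInteger_bracket n).1
  have hDid : ((demandSum (fun j => (j : ℤ)) 1 n : ℤ) : ℝ) = (n : ℝ) * (n - 1) / 2 := by
    have h := congrArg (fun z : ℤ => (z : ℝ)) (two_mul_demandSum_id n); push_cast at h; linarith
  have hDle : 2 * ((demandSum (lawPow 3) 1 n : ℤ) : ℝ) ≤ (ceilSqrt n : ℝ) * n * (n + 1) - 2 * n := by
    exact_mod_cast two_mul_demandSum_lawPow_three_le n
  have hDpos : (0 : ℝ) < ((demandSum (lawPow 3) 1 n : ℤ) : ℝ) := by rw [hDid] at hDge; nlinarith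
  have hl : (0 : ℝ) ≤ l := Nat.cast_nonneg l
  push_cast
  rw [div_one, div_le_div_iff₀ (by linarith) hDpos]
  nlinarith [mul_nonneg hl (by linarith : (0 : ℝ) ≤ n)]

/-- **`κ = 5/2`: `u(l) ≤ u_print(l)`** (finite), since `Σ(⌈j^{5/2}⌉−1) ≥ Σ(j²−1) > 0` (`n ≥ 2`). [folklore] -/
theorem uConst_lawPow_five_le {n : ℕ} (hn : 2 ≤ n) (l : ℕ) : uConst (lawPow 5) 1 l n ≤ uConst (fun j => (j : ℤ) ^ 2) 1 l n := by
  unfold uConst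
  have hD2 : (0 : ℝ) < ((demandSum (fun j => (j : ℤ) ^ 2) 1 n : ℤ) : ℝ) := by exact_mod_cast demandSum_sq_pos hn
  have hle : ((demandSum (fun j => (j : ℤ) ^ 2) 1 n : ℤ) : ℝ) ≤ ((demandSum (lawPow 5) 1 n : ℤ) : ℝ) := by
    exact_mod_cast (demandSum_halfInteger_bracket n).2.2.1
  have hA : (0 : ℝ) ≤ 2 * (l : ℝ) * ((n : ℝ) * (n + 3) / 2) := by positivity
  push_cast
  rw [div_one, div_one]
  exact div_le_div_of_nonneg_left hA hD2 hle

end Summit.ABC.IUTFork.Repair.RH.ReqsideWeightLaws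

end
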